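import Mathlib
import HarnessLib
import Literature.Analysis.FluidPDE.SelfSimilar
import Literature.Analysis.FluidPDE.LocalTypeI
import Literature.Analysis.FluidPDE.VectorCalculus
import Literature.Analysis.FluidPDE.CurlIsometryCovariance
import Literature.Analysis.UnboundedOperators.HeatKernel
import Summits.NavierStokesRegularity.NavierStokesRegularity.Theorems.LocalSineTubeDoorProfileAlignedWindowRigidityAncient
import Summits.NavierStokesRegularity.NavierStokesRegularity.Theorems.PoloidalWindowDoorPoloidalWindowRigidityAxisymmetric
import Summits.NavierStokesRegularity.NavierStokesRegularity.Theorems.PoloidalWindowDoorPoloidalWindowRigidityStrata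
import Summits.NavierStokesRegularity.NavierStokesRegularity.Theorems.PoloidalWindowDoorPoloidalWindowRigidityFlat

/-!
# Route `PoloidalWindowDoor`, crux `PoloidalWindowRigidity` (K2, stmt-NavierStokesRegularity-19708), line
# `slicesharp-screw` — SPACE–TIME SIMILARITY STRATA of the residue

Cell ns-regularity-ideate, seat ns-poloidal-K2-p2 (stub-worker; lands `--supports` the crux, `--as helper`).  The
residue S2′ of the line excludes every continuous SPATIAL symmetry (translations, rotations and screw motions about
any axis: `…OneSlice`, `…AnyAxis`, `…ScrewAnyAxis`, S1) and the self-similar stratum about the apex `(0,0)`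
(`…Strata.eq_zero_of_scaleInvariant`, Tsai).  This file records the remaining cheap strata of the symmetry group of
the problem — the similarity group of `ℝ³` times the time shifts — inside the route's Type-I class `𝔓(C)`
(`‖v(t)‖ ≤ C/√(−t)`, continuous, unit-viscosity Oseen–mild, divergence-free slices):

* `eq_zero_of_norm_le_shift` — THE GAUGE KILLS EVERY RELATIVE PERIODIC ORBIT: if for some period `P > 0` every value
  `‖v(s,y)‖` is dominated by some value `‖v(s − P, y')‖` one period earlier, then `v ≡ 0` (iterate and use
  `C/√(nP − s) → 0`; only the rate is used).  `eq_zero_of_relativePeriodic`: in particular a profile with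
  `v(s − P, g y) = L(v(s,y))` (`g` ANY self-map of `ℝ³`, `L` a linear isometry) vanishes — travelling waves
  `V(x − ct)`, rotating waves `R_{ωt}V(R_{−ωt}x)`, helical waves, and every other invariance under «time shift ∘
  isometry» (the time-periodic/steady cases are `…Strata.eq_zero_of_timePeriodic` / `eq_zero_of_steady`).
* `eq_zero_of_scaleInvariant_centre` — self-similar about ANY spatial centre `c` (apex `(0,c)`) ⇒ trivial
  (`…Axisymmetric.class_translate` + `…Strata.eq_zero_of_scaleInvariant`).
* `curl_similarity` — the vorticity of a similar copy: for `V` differentiable,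
  `curl (y ↦ λ L V(d + λ L⁻¹y)) (y) = (λ² det L) • L (curl V (d + λ L⁻¹ y))` (chain rule + the tree's pseudovector law
  `curl_conj_linearIsometryEquiv`).
* `eq_zero_of_similarSlices_tilted` — **NO SLICE IS A TILTED SIMILAR COPY OF A SLICE**: if `v` is poloidal along
  `e₃` and ONE slice is the image of some slice (the same or another) under a similarity of `ℝ³` acting on fields,
  `v(s, y) = λ L v(σ, d + λ L⁻¹ y)` (any `λ`, any centre `d`, any two times `s, σ < 0`), whose linear part MOVES THE
  VERTICAL AXIS (`L e₃ ∦ e₃`), then the slice `v(s)` is poloidal along `e₃` AND along `L e₃`, hence `v ≡ 0`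
  (`…Strata.eq_zero_of_twoDirections`).  This one lemma empties, inside the residue: rotating self-similarity
  (Perelman's «RSS» ansatz, scaling ∘ rotation) about any TILTED axis, discrete self-similarity twisted by a tilted
  rotation, and every DISCRETE isometric symmetry of a single slice that tilts the vertical (a rotation by any angle
  about a tilted axis, a reflection in a tilted plane).

What is NOT settled here (census, located): similarities FIXING the vertical axis (`L e₃ = ±e₃`).  Among the
one-parameter subgroups of the symmetry group this leaves exactly ONE stratum of the residue: ROTATING SELF-SIMILARITY
ABOUT A VERTICAL AXIS, `v(t,x) = (−t)^{−1/2} R_{α log(−t)} u(R_{−α log(−t)} x/√(−t))`, `α ≠ 0` — for general (non-poloidal)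
bounded profiles its triviality is OPEN even under the decay `|u(y)| ≤ C/(1+|y|)` (Bradshaw–Tsai, CPDE 42 (2017),
arXiv:1610.05680, Appendix, Open Problem 5.2, «proposed by Perelman»; no analogue of the NRS/Tsai head `Λ` has a
maximum principle: the rotation adds `α ∂_θ p` to `−ΔΛ + (u + y/2 − αJy)·∇Λ = −|ω|²`), and backward DISCRETE
self-similarity (ibid. Open Problem 5.1).  So the poloidal residue S2′ CONTAINS the poloidal cases of these two named
open problems.

WHAT THIS IS NOT: not a claim about Navier–Stokes regularity and not the open residue — settled strata of it and the
location of the unsettled symmetric ones (bears_on LADDER-NS N0, rung N0-LocalTubeDoorPoloidal).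
-/

noncomputable section

-- the summit and its single sub-problem share the name (CONVENTIONS §1), as in every Theorems file
set_option linter.dupNamespace false

namespace Summit.NavierStokesRegularity.NavierStokesRegularity.Theorems.PoloidalWindowDoorPoloidalWindowRigiditySimilarity

open MeasureTheory Set Function Filter Topology TopologicalSpace Metric
open scoped RealInnerProductSpace InnerProductSpace
open Literature.Analysis Literature.Analysis.FluidPDE
open Summit.NavierStokesRegularity.NavierStokesRegularity.Theorems.LocalSineTubeDoorProfileAlignedWindowRigidityAncient
open Summit.NavierStokesRegularity.NavierStokesRegularity.Theorems.PoloidalWindowDoorPoloidalWindowRigidityAxisymmetric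
open Summit.NavierStokesRegularity.NavierStokesRegularity.Theorems.PoloidalWindowDoorPoloidalWindowRigidityStrata

variable {C : ℝ} {v : ℝ → EuclideanSpace ℝ (Fin 3) → EuclideanSpace ℝ (Fin 3)}

/-! ### the gauge kills every relative periodic orbit -/

/-- **The Type-I gauge kills every relative periodic orbit.** If a field with the Type-I rate `‖v(t,y)‖ ≤ C/√(−t)`
has a period `P > 0` such that every value `‖v(s,y)‖` (`s < 0`) is dominated by SOME value `‖v(s − P, y')‖` one period
earlier, then `v ≡ 0` on the slab: iterating, `‖v(s,y)‖ ≤ ‖v(s − nP, yₙ)‖ ≤ C/√(nP − s) → 0`.  Only the rate is used. -/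
theorem eq_zero_of_norm_le_shift (hrate : HasTypeITimeDecay C v) {P : ℝ} (hP : 0 < P)
    (h : ∀ s < 0, ∀ y, ∃ y', ‖v s y‖ ≤ ‖v (s - P) y'‖) : ∀ t < 0, ∀ x, v t x = 0 := by
  intro t ht x
  -- backward iterates of the period
  have hiter : ∀ n : ℕ, ∃ y, ‖v t x‖ ≤ ‖v (t - n * P) y‖ := by
    intro n
    induction n with
    | zero => exact ⟨x, by simp⟩
    | succ n ih =>
      obtain ⟨y, hy⟩ := ih
      have hneg : t - n * P < 0 := by
        have : (0 : ℝ) ≤ n * P := by positivity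
        linarith
      obtain ⟨y', hy'⟩ := h _ hneg y
      refine ⟨y', hy.trans ?_⟩
      have e : t - (↑(n + 1) : ℝ) * P = t - n * P - P := by push_cast; ring
      rw [e]
      exact hy'
  by_contra hne
  have hδ : 0 < ‖v t x‖ := norm_pos_iff.2 hne
  -- choose `n` with `(C / ‖v t x‖)² < nP − t`
  obtain ⟨n, hn⟩ : ∃ n : ℕ, (C / ‖v t x‖) ^ 2 / P < n := exists_nat_gt _
  have hnP : (C / ‖v t x‖) ^ 2 < n * P - t := by
    have h1 : (C / ‖v t x‖) ^ 2 < n * P := (div_lt_iff₀ hP).1 hn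
    linarith
  have hneg : t - n * P < 0 := by
    have : (0 : ℝ) ≤ (C / ‖v t x‖) ^ 2 := sq_nonneg _
    linarith
  obtain ⟨y, hy⟩ := hiter n
  have key := hrate (t - n * P) hneg y
  have hsqrt : C / ‖v t x‖ < Real.sqrt (-(t - n * P)) := by
    rw [show -(t - n * P) = n * P - t by ring]
    calc C / ‖v t x‖ ≤ |C / ‖v t x‖| := le_abs_self _
      _ = Real.sqrt ((C / ‖v t x‖) ^ 2) := (Real.sqrt_sq_eq_abs _).symm
      _ < Real.sqrt (n * P - t) := Real.sqrt_lt_sqrt (sq_nonneg _) hnP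
  have hpos : 0 < Real.sqrt (-(t - n * P)) := Real.sqrt_pos.2 (neg_pos.2 hneg)
  -- `‖v t x‖ ≤ ‖v (t − nP) y‖ ≤ C / √(nP − t) < ‖v t x‖`
  have h3 : C / Real.sqrt (-(t - n * P)) < ‖v t x‖ := by
    rw [div_lt_iff₀ hpos]
    calc C = C / ‖v t x‖ * ‖v t x‖ := by rw [div_mul_cancel₀ _ hδ.ne']
      _ < Real.sqrt (-(t - n * P)) * ‖v t x‖ := mul_lt_mul_of_pos_right hsqrt hδ
      _ = ‖v t x‖ * Real.sqrt (-(t - n * P)) := mul_comm _ _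
  linarith

/-- **Relative periodic orbits modulo isometries are trivial in the gauge.** If `v(s − P, g y) = L (v(s, y))` for all
`s < 0`, `y`, with `P > 0`, `g` any self-map of `ℝ³` and `L` a linear isometry — travelling waves (`g y = y − Pc`,
`L = 1`), rotating waves (`g = L = R_{−ωP}`), helical waves, a time shift composed with any rigid motion — then
`v ≡ 0` on the slab. -/
theorem eq_zero_of_relativePeriodic (hrate : HasTypeITimeDecay C v) {P : ℝ} (hP : 0 < P)
    (g : EuclideanSpace ℝ (Fin 3) → EuclideanSpace ℝ (Fin 3))
    (L : EuclideanSpace ℝ (Fin 3) ≃ₗᵢ[ℝ] EuclideanSpace ℝ (Fin 3))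
    (h : ∀ s < 0, ∀ y, v (s - P) (g y) = L (v s y)) : ∀ t < 0, ∀ x, v t x = 0 :=
  eq_zero_of_norm_le_shift hrate hP fun s hs y => ⟨g y, by rw [h s hs y, LinearIsometryEquiv.norm_map]⟩

/-- Relative periodic orbits: not backward-singular. -/
theorem nonflatLiouville_of_relativePeriodic (hrate : HasTypeITimeDecay C v) {P : ℝ} (hP : 0 < P)
    (g : EuclideanSpace ℝ (Fin 3) → EuclideanSpace ℝ (Fin 3))
    (L : EuclideanSpace ℝ (Fin 3) ≃ₗᵢ[ℝ] EuclideanSpace ℝ (Fin 3))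
    (h : ∀ s < 0, ∀ y, v (s - P) (g y) = L (v s y)) : ¬ IsBackwardSingularPoint v 0 :=
  Summit.NavierStokesRegularity.NavierStokesRegularity.Theorems.PoloidalWindowDoorPoloidalWindowRigidityFlat.not_backwardSingular_of_zero
    (eq_zero_of_relativePeriodic hrate hP g L h)

/-! ### self-similar about any spatial centre -/

/-- **Scale-invariant about ANY centre ⇒ trivial.** If a profile of the route's Type-I class is invariant under the
parabolic scalings about the apex `(0, c)`, `λ v(λ²s, c + λ(y − c)) = v(s, y)` for all `λ > 0`, then `v ≡ 0` on the
slab (translate `c` to the origin — `…Axisymmetric.class_translate` — and use `…Strata.eq_zero_of_scaleInvariant`,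
i.e. Leray's reduction + Tsai's theorem for bounded profiles). -/
theorem eq_zero_of_scaleInvariant_centre (hrate : HasTypeITimeDecay C v)
    (hcont : ContinuousOn (uncurry v) (Iio (0 : ℝ) ×ˢ univ))
    (hmild : ∀ s t : ℝ, s < t → t < 0 → ∀ x,
      v t x = UnboundedOperators.heatExtension (v s) (t - s) x - oseenDuhamel 1 s v v t x)
    (hdiv : ∀ t < 0, VectorCalculus.IsDivFree (v t)) (c : EuclideanSpace ℝ (Fin 3))
    (hsc : ∀ lam : ℝ, 0 < lam → ∀ s < 0, ∀ y, lam • v (lam ^ 2 * s) (c + lam • (y - c)) = v s y) :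
    ∀ t < 0, ∀ x, v t x = 0 := by
  obtain ⟨hrate₁, hcont₁, hmild₁, hdiv₁⟩ := class_translate c hrate hcont hmild hdiv
  have hzero : ∀ t < 0, ∀ y, (fun t y => v t (y + c)) t y = 0 := by
    refine eq_zero_of_scaleInvariant hrate₁ hcont₁ hmild₁ hdiv₁ fun lam hlam s hs y => ?_
    have h1 := hsc lam hlam s hs (y + c)
    simp only [add_sub_cancel_right] at h1
    change lam • v (lam ^ 2 * s) (lam • y + c) = v s (y + c)
    rw [add_comm (lam • y) c]
    exact h1
  intro t ht x
  have h := hzero t ht (x - c)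
  simp only [sub_add_cancel] at h
  exact h

/-- Scale-invariant about any centre: not backward-singular. -/
theorem nonflatLiouville_of_scaleInvariant_centre (hrate : HasTypeITimeDecay C v)
    (hcont : ContinuousOn (uncurry v) (Iio (0 : ℝ) ×ˢ univ))
    (hmild : ∀ s t : ℝ, s < t → t < 0 → ∀ x,
      v t x = UnboundedOperators.heatExtension (v s) (t - s) x - oseenDuhamel 1 s v v t x)
    (hdiv : ∀ t < 0, VectorCalculus.IsDivFree (v t)) (c : EuclideanSpace ℝ (Fin 3))
    (hsc : ∀ lam : ℝ, 0 < lam → ∀ s < 0, ∀ y, lam • v (lam ^ 2 * s) (c + lam • (y - c)) = v s y) :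
    ¬ IsBackwardSingularPoint v 0 :=
  Summit.NavierStokesRegularity.NavierStokesRegularity.Theorems.PoloidalWindowDoorPoloidalWindowRigidityFlat.not_backwardSingular_of_zero
    (eq_zero_of_scaleInvariant_centre hrate hcont hmild hdiv c hsc)

/-! ### the vorticity of a similar copy -/

/-- Chain rule for a homothety: `D(V(d + λ·))(z) = λ • DV(d + λ z)` for `V` differentiable. -/
theorem fderiv_comp_homothety {V : EuclideanSpace ℝ (Fin 3) → EuclideanSpace ℝ (Fin 3)} (hV : Differentiable ℝ V)
    (lam : ℝ) (d z : EuclideanSpace ℝ (Fin 3)) :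
    fderiv ℝ (fun w => V (d + lam • w)) z = lam • fderiv ℝ V (d + lam • z) := by
  have haff : HasFDerivAt (fun w : EuclideanSpace ℝ (Fin 3) => d + lam • w)
      (lam • ContinuousLinearMap.id ℝ (EuclideanSpace ℝ (Fin 3))) z := by
    have h1 : HasFDerivAt (fun w : EuclideanSpace ℝ (Fin 3) => lam • w)
        (lam • ContinuousLinearMap.id ℝ (EuclideanSpace ℝ (Fin 3))) z :=
      (ContinuousLinearMap.id ℝ (EuclideanSpace ℝ (Fin 3))).hasFDerivAt.const_smul lam
    exact (h1.const_add d)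
  have h : HasFDerivAt (fun w => V (d + lam • w))
      ((fderiv ℝ V (d + lam • z)).comp (lam • ContinuousLinearMap.id ℝ (EuclideanSpace ℝ (Fin 3)))) z :=
    (hV (d + lam • z)).hasFDerivAt.comp z haff
  rw [h.fderiv, ContinuousLinearMap.comp_smul, ContinuousLinearMap.comp_id]

/-- The curl of a rescaled translate: `curl (z ↦ V(d + λ z)) (z) = λ • curl V (d + λ z)`. -/
theorem curl_comp_homothety {V : EuclideanSpace ℝ (Fin 3) → EuclideanSpace ℝ (Fin 3)} (hV : Differentiable ℝ V)
    (lam : ℝ) (d z : EuclideanSpace ℝ (Fin 3)) :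
    curl (fun w => V (d + lam • w)) z = lam • curl V (d + lam • z) := by
  rw [curl_eq_curlCLM, curl_eq_curlCLM, fderiv_comp_homothety hV, map_smul]

/-- The curl of a scalar multiple: `curl (λ • W) = λ • curl W` for `W` differentiable. -/
theorem curl_const_smul {W : EuclideanSpace ℝ (Fin 3) → EuclideanSpace ℝ (Fin 3)} (hW : Differentiable ℝ W)
    (lam : ℝ) (z : EuclideanSpace ℝ (Fin 3)) :
    curl (fun w => lam • W w) z = lam • curl W z := by
  have h : fderiv ℝ (fun w => lam • W w) z = lam • fderiv ℝ W z := fderiv_const_smul (hW z) lam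
  rw [curl_eq_curlCLM, curl_eq_curlCLM, h, map_smul]

/-- **The vorticity of a similar copy** (pseudovector law + scaling): for `V` differentiable, `L` a linear isometry,
`λ ∈ ℝ`, `d ∈ ℝ³`, `curl (y ↦ λ L V(d + λ L⁻¹ y)) (y) = (det L · λ²) • L (curl V (d + λ L⁻¹ y))`. -/
theorem curl_similarity {V : EuclideanSpace ℝ (Fin 3) → EuclideanSpace ℝ (Fin 3)} (hV : Differentiable ℝ V)
    (L : EuclideanSpace ℝ (Fin 3) ≃ₗᵢ[ℝ] EuclideanSpace ℝ (Fin 3)) (lam : ℝ) (d y : EuclideanSpace ℝ (Fin 3)) :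
    curl (fun w => lam • L (V (d + lam • L.symm w))) y =
      ((L : EuclideanSpace ℝ (Fin 3) →L[ℝ] EuclideanSpace ℝ (Fin 3)).det * lam ^ 2) •
        L (curl V (d + lam • L.symm y)) := by
  -- `y ↦ λ L V(d + λ L⁻¹ y) = L (W (L⁻¹ y))` with `W z = λ V(d + λ z)`
  set W : EuclideanSpace ℝ (Fin 3) → EuclideanSpace ℝ (Fin 3) := fun z => lam • V (d + lam • z) with hW
  have hWd : Differentiable ℝ (fun z => V (d + lam • z)) := fun z =>
    (hV (d + lam • z)).comp z ((differentiableAt_id.const_smul lam).const_add d)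
  have e : (fun w => lam • L (V (d + lam • L.symm w))) = fun w => L (W (L.symm w)) := by
    funext w
    rw [hW, LinearIsometryEquiv.map_smul]
  rw [e, curl_conj_linearIsometryEquiv, hW, curl_const_smul hWd, curl_comp_homothety hV, smul_smul,
    LinearIsometryEquiv.map_smul, smul_smul, sq]

/-! ### no slice is a tilted similar copy of a slice -/

/-- **No slice of the residue is a TILTED similar copy of a slice.** Let `v` be a profile of the route's Type-I class,
poloidal along `e₃` on every slice.  If one slice is the image of a slice under a similarity of `ℝ³` acting on vector
fields — `v(s, y) = λ L v(σ, d + λ L⁻¹ y)` for all `y`, with `s, σ < 0` (possibly `s = σ`), `λ ∈ ℝ`, `d ∈ ℝ³`, `L` a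
linear isometry — and the linear part tilts the vertical, `L e₃ × e₃ ≠ 0`, then `v ≡ 0` on the slab: by the
pseudovector law `curl v(s) = (det L·λ²) L (curl v(σ) ∘ …)`, so the slice `v(s)` is poloidal along `L e₃` as well as
along `e₃`, and `…Strata.eq_zero_of_twoDirections` applies.  Special cases: rotating self-similarity («RSS»,
`s = λ²σ`, `L = R_{n, α log λ}`) about a tilted axis `n`; discrete self-similarity twisted by a tilted rotation; for
`λ = 1`, `s = σ`: any DISCRETE isometric symmetry of one slice tilting the vertical (rotation by any angle about a
tilted axis, reflection in a tilted plane). -/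
theorem eq_zero_of_similarSlices_tilted (hrate : HasTypeITimeDecay C v)
    (hcont : ContinuousOn (uncurry v) (Iio (0 : ℝ) ×ˢ univ))
    (hmild : ∀ s t : ℝ, s < t → t < 0 → ∀ x,
      v t x = UnboundedOperators.heatExtension (v s) (t - s) x - oseenDuhamel 1 s v v t x)
    (hdiv : ∀ t < 0, VectorCalculus.IsDivFree (v t))
    (hpol : ∀ s < 0, ∀ y, ⟪curl (v s) y, EuclideanSpace.single 2 1⟫_ℝ = 0)
    (L : EuclideanSpace ℝ (Fin 3) ≃ₗᵢ[ℝ] EuclideanSpace ℝ (Fin 3))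
    (htilt : cross (L (EuclideanSpace.single 2 1)) (EuclideanSpace.single 2 1) ≠ 0)
    (lam : ℝ) (d : EuclideanSpace ℝ (Fin 3)) {s σ : ℝ} (hs : s < 0) (hσ : σ < 0)
    (hsim : ∀ y, v s y = lam • L (v σ (d + lam • L.symm y))) :
    ∀ t < 0, ∀ x, v t x = 0 := by
  have hbdd := bdd_of_hasTypeITimeDecay hrate
  have hVd : Differentiable ℝ (v σ) :=
    ((analyticOnNhd_slice hcont hbdd hmild hσ).contDiff (n := 1)).differentiable one_ne_zero
  have hfun : v s = fun y => lam • L (v σ (d + lam • L.symm y)) := funext hsim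
  -- the slice `v s` is poloidal along `L e₃`
  have h1 : ∀ y, ⟪curl (v s) y, L (EuclideanSpace.single 2 1)⟫_ℝ = 0 := by
    intro y
    rw [hfun, curl_similarity hVd, inner_smul_left, LinearIsometryEquiv.inner_map_map,
      hpol σ hσ (d + lam • L.symm y)]
    simp
  exact eq_zero_of_twoDirections hrate hcont hmild hdiv htilt hs h1 (hpol s hs)

/-- No slice is a tilted similar copy of a slice: not backward-singular. -/
theorem nonflatLiouville_of_similarSlices_tilted (hrate : HasTypeITimeDecay C v)
    (hcont : ContinuousOn (uncurry v) (Iio (0 : ℝ) ×ˢ univ))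
    (hmild : ∀ s t : ℝ, s < t → t < 0 → ∀ x,
      v t x = UnboundedOperators.heatExtension (v s) (t - s) x - oseenDuhamel 1 s v v t x)
    (hdiv : ∀ t < 0, VectorCalculus.IsDivFree (v t))
    (hpol : ∀ s < 0, ∀ y, ⟪curl (v s) y, EuclideanSpace.single 2 1⟫_ℝ = 0)
    (L : EuclideanSpace ℝ (Fin 3) ≃ₗᵢ[ℝ] EuclideanSpace ℝ (Fin 3))
    (htilt : cross (L (EuclideanSpace.single 2 1)) (EuclideanSpace.single 2 1) ≠ 0)
    (lam : ℝ) (d : EuclideanSpace ℝ (Fin 3)) {s σ : ℝ} (hs : s < 0) (hσ : σ < 0)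
    (hsim : ∀ y, v s y = lam • L (v σ (d + lam • L.symm y))) :
    ¬ IsBackwardSingularPoint v 0 :=
  Summit.NavierStokesRegularity.NavierStokesRegularity.Theorems.PoloidalWindowDoorPoloidalWindowRigidityFlat.not_backwardSingular_of_zero
    (eq_zero_of_similarSlices_tilted hrate hcont hmild hdiv hpol L htilt lam d hs hσ hsim)

/-- **Rotating self-similarity about a TILTED axis is empty in the residue.** The one-parameter stratum form: if a
profile of the class, poloidal along `e₃`, is invariant under a one-parameter family of similarities
`v(s, y) = λ L_λ v(λ² s, λ L_λ⁻¹ y)` (`λ > 0`; `L_λ` linear isometries, e.g. `L_λ = R_{n, α log λ}` — the «RSS» ansatz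
about the axis `ℝn` through the apex), and SOME `L_λ` tilts the vertical, then `v ≡ 0`.  (With `L_λ e₃ = ±e₃` for all
`λ` — a vertical axis — the stratum is NOT settled here: see the file header.) -/
theorem eq_zero_of_spiralSelfSimilar_tilted (hrate : HasTypeITimeDecay C v)
    (hcont : ContinuousOn (uncurry v) (Iio (0 : ℝ) ×ˢ univ))
    (hmild : ∀ s t : ℝ, s < t → t < 0 → ∀ x,
      v t x = UnboundedOperators.heatExtension (v s) (t - s) x - oseenDuhamel 1 s v v t x)
    (hdiv : ∀ t < 0, VectorCalculus.IsDivFree (v t))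
    (hpol : ∀ s < 0, ∀ y, ⟪curl (v s) y, EuclideanSpace.single 2 1⟫_ℝ = 0)
    (Lfam : ℝ → (EuclideanSpace ℝ (Fin 3) ≃ₗᵢ[ℝ] EuclideanSpace ℝ (Fin 3)))
    (hsim : ∀ lam : ℝ, 0 < lam → ∀ s < 0, ∀ y,
      v s y = lam • Lfam lam (v (lam ^ 2 * s) (lam • (Lfam lam).symm y)))
    {lam₀ : ℝ} (hlam₀ : 0 < lam₀)
    (htilt : cross (Lfam lam₀ (EuclideanSpace.single 2 1)) (EuclideanSpace.single 2 1) ≠ 0) :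
    ∀ t < 0, ∀ x, v t x = 0 := by
  have hσ : lam₀ ^ 2 * (-1) < 0 := by nlinarith
  refine eq_zero_of_similarSlices_tilted hrate hcont hmild hdiv hpol (Lfam lam₀) htilt lam₀ 0
    (show (-1 : ℝ) < 0 by norm_num) hσ fun y => ?_
  rw [zero_add]
  exact hsim lam₀ hlam₀ (-1) (by norm_num) y

end Summit.NavierStokesRegularity.NavierStokesRegularity.Theorems.PoloidalWindowDoorPoloidalWindowRigiditySimilarity

end
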